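import Literature.AlgebraicGeometry.Motives.HodgeStructureCentralizerInternalBlocks
import Literature.AlgebraicGeometry.Motives.HodgeStructureStableSubHodgeStructuresBlockMatrixAlgebra
import Literature.AlgebraicGeometry.Motives.HodgeStructureLefschetzGroupTransport
import Literature.AlgebraicGeometry.Motives.HodgeStructureLefschetzGroupFiniteDirectSum
import HarnessLib

/-!
# «`C(A^r) = C(A)`» INTERNALLY and MILNE'S PROP. 1.1 IN FULL: for an internal direct sum `V' = ⊕_i T_i` of sub-Hodge structures all
# isomorphic to one Hodge structure `H₀`, `H₀^{⊕ι} ≅ H'` as Hodge structures and `C(H') ≃ₐ[ℚ] C(H₀)`; hence for every isotypically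
# labelled irreducible decomposition `T` of a `ℚ`-Hodge structure, `C(H) ≃ₐ[ℚ] Π_k C(T_k)` over the REPRESENTATIVES `T_k` of the
# isotypy classes («an isomorphism `C(A₁) × ⋯ × C(A_s) → C(A)`», `Aᵢ` the simple factors), and for a canonical block `S ⊇ U`
# irreducible of a polarizable `H`, `C(S) ≃ₐ[ℚ] C(U)` (Milne 1999 §1 p. 643 and Prop. 1.1)

[topic AlgebraicGeometry/Motives]

Layer `Literature/AlgebraicGeometry/Motives`, lane `lit-hodgefound` (Track 2 foundations library; prover seat
`lit-hodgefound-p02`, generation 52, self-proposed row g52-#5). THEOREMS ONLY: no definition, no named fact (net debt `0`),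
no instance, no notation.  Joins, BY NAME (nothing restated): g52-#3 `Motives/HodgeStructureCentralizerInternalBlocks`
(`C(H) ≃ₐ Π_k C(W_k)` along Hom-orthogonal internal blocks, `exists_algEquiv_pi_centralizer_of_hom_orthogonal`), p34's EXTERNAL
theorems `centralizerPiConstAlgEquiv` (`C(H₀) ≃ₐ C(H₀^{⊕ι})`, `Motives/HodgeStructureLefschetzGroupFiniteDirectSum`) and
`centralizerEndAlgComapEquivAlgEquiv` (transport `C(e^* H) ≃ₐ C(H)`, `Motives/HodgeStructureLefschetzGroupTransport`), the morphism
`Hom.piDesc : (⊕_j H_j) → H` (`Motives/HodgeStructureDirectSum`), the isotypic blocks `W_k = ⨆_{c i = k} Tᵢ` read internally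
(`isInternal_comapSubtype_iSup'_fiber`, `exists_hom_comapSubtype_bijective`, `hom_iSup'_fiber_eq_zero`, `isInternal_iSup'_fiber`;
`Motives/HodgeStructureIsotypicEndomorphismAlgebra`), `card_mul_finrank_eq_finrank_of_isInternal`
(`Motives/SubHodgeStructureOfIsotypicHodgeStructure`), and g52-#1∕#2 (a minimal stable `S` is a block `W_k`; irreducibles in it are
isomorphic: `existsUnique_iSup'_fiber_eq_of_minimal_stable`, `exists_hom_bijective_iff_eq_of_minimal_stable`).  p34's files give
Prop. 1.1 for the external model `⊕_j H_j^{⊕κ_j}` (`centralizerIsogenyFactorsAlgEquiv`); here the statement is read on the Hodge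
structure `H` itself, with `T_k ⊆ V` actual sub-Hodge structures.

## The source, verbatim

J. S. Milne, *Lefschetz classes on abelian varieties*, Duke Math. J. 96 (1999) 639–675 [Milne1999LefschetzClasses] (held
`paper:doi-10-1215-s0012-7094-99-09620-5`), §1 p. 643: "An isogeny `α : A → B` defines an isomorphism `γ ↦ V(α) ∘ γ ∘ V(α)⁻¹ :
C(A) → C(B)` … `V(A^r) = rV(A)`, and the diagonal action of `C(A)` on `rV(A)` identifies `C(A)` with `C(A^r)`"; "**Proposition 1.1.**
Let `A₁, …, A_s` be a set of representatives for the simple isogeny factors of `A`, so that there exists an isogeny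
`A₁^{r₁} × ⋯ × A_s^{r_s} → A` for some `rᵢ > 0`. Any such isogeny induces an isomorphism `C(A₁) × ⋯ × C(A_s) → C(A)` of
`k`-algebras with involution, which is independent of the choice of the isogeny."  Also M. Green, P. Griffiths, M. Kerr
[GreenGriffithsKerr2012] §V.B p. 159 («`V = V₁^{⊕m₁} ⊕ ⋯ ⊕ V_ℓ^{⊕m_ℓ}`»), H. Lange [Lange2023AbelianVarietiesComplex] §2.4.4 Cor. 2.4.26
(p. 124), C. Voisin [VoisinHodgeI2002] §7.3.1 Lemma 7.23 ∕ 7.26.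

## Dictionary and what is proved (namespace `Literature.AlgebraicGeometry.Motives.HodgeStructure`)

`C(H) = Subalgebra.centralizer ℚ (H.endAlg : Set (Module.End ℚ V))` (Milne's centralizer `End_{E_φ}(V)`); an internal direct sum
`T : ι → SubHodgeStructure H'` (`DirectSum.IsInternal`) with isomorphisms `rᵢ : H₀ ⥲ Tᵢ` (bijective morphisms); `H₀^{⊕ι} =
HodgeStructure.pi (fun _ : ι ↦ H₀)`.  The universal index types of the generic lemmas are small (`ι : Type`), as in p34's `pi`
files; arbitrary finite index types are reached by re-indexing along `Fintype.equivFin`.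

* §1 `eq_comapEquiv_of_hom_bijective` (a bijective morphism identifies the source with the transport of the target),
  **`nonempty_centralizer_endAlg_algEquiv_of_hom_bijective`** (`H₁ ≅ H₂ ⟹ C(H₁) ≃ₐ C(H₂)` — «`γ ↦ V(α) ∘ γ ∘ V(α)⁻¹`»).
* §2 **`bijective_piDesc_subtypeHom_comp_toLinearMap`** («`V(A^r) = rV(A)`»: `(xᵢ)ᵢ ↦ Σᵢ rᵢ xᵢ` is a Hodge isomorphism
  `H₀^{⊕ι} ⥲ H'`), **`nonempty_centralizer_endAlg_algEquiv_of_isInternal_of_forall_bijective`** («identifies `C(A)` with `C(A^r)`»: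
  `C(H') ≃ₐ[ℚ] C(H₀)`) (with a private re-indexing helper).
* §3 **`nonempty_centralizer_endAlg_iSup'_fiber_algEquiv`** (`C(W_k) ≃ₐ[ℚ] C(T_k)` for every isotypic block of a labelled irreducible
  decomposition), **`nonempty_centralizer_endAlg_algEquiv_pi_of_labelling`** (PROP. 1.1: `C(H) ≃ₐ[ℚ] Π_k C(T_k)` over the
  representatives), `finrank_centralizer_endAlg_eq_sum_of_labelling` (`dim C(H) = Σ_k dim C(T_k)`).
* §4 **`nonempty_centralizer_endAlg_algEquiv_of_minimal_stable`** (polarizable `H`, `S` minimal `E_φ`-stable, `U ⊆ S` irreducible: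
  `C(S) ≃ₐ[ℚ] C(U)`).
-/

noncomputable section

namespace Literature.AlgebraicGeometry.Motives

namespace HodgeStructure

universe u

variable {n : ℤ}

/-! ## §1 Transport of `C` along a bijective morphism -/

section Transport

variable {V W : Type u} [AddCommGroup V] [Module ℚ V] [AddCommGroup W] [Module ℚ W]
  {H₁ : HodgeStructure V n} {H₂ : HodgeStructure W n}

/-- A bijective morphism `g : H₁ → H₂` identifies `H₁` with the transport `e^* H₂` of `H₂` along the underlying linear equivalence
`e` (the inverse is a morphism, Voisin Lemma 7.23); same-universe copy of the tree's `HodgeStructure.eq_comapEquiv_of_bijective`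
(`Pohlmann1968/…`, outside this file's import cone). [cite: VoisinHodgeI2002, §7.3.1 Lemma 7.23] -/
theorem eq_comapEquiv_of_hom_bijective (g : Hom H₁ H₂) (hg : Function.Bijective g.toLinearMap) :
    H₁ = H₂.comapEquiv (LinearEquiv.ofBijective g.toLinearMap hg) := by
  have he : ((LinearEquiv.ofBijective g.toLinearMap hg : V ≃ₗ[ℚ] W) : V →ₗ[ℚ] W) = g.toLinearMap :=
    LinearMap.ext fun _ => rfl
  ext p x
  rw [comapEquiv_F, Submodule.mem_comap, he]
  refine ⟨fun hx => g.map_F_le p ⟨x, hx, rfl⟩, fun hx => ?_⟩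
  have h := (g.inverse hg).map_F_le p ⟨_, hx, rfl⟩
  have hcomp : (g.inverse hg).toLinearMap ∘ₗ g.toLinearMap = LinearMap.id :=
    LinearMap.ext fun y => g.inverse_apply_apply hg y
  rwa [← LinearMap.comp_apply, ← LinearMap.baseChange_comp, hcomp, LinearMap.baseChange_id, LinearMap.id_apply] at h

/-- **«An isogeny `α : A → B` defines an isomorphism `γ ↦ V(α) ∘ γ ∘ V(α)⁻¹ : C(A) → C(B)`»**: isomorphic Hodge structures have
isomorphic Milne centralizers, `C(H₁) ≃ₐ[ℚ] C(H₂)` (p34's transport `centralizerEndAlgComapEquivAlgEquiv` read through §1).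
[cite: Milne1999LefschetzClasses, §1 p. 643 L7–L8] [cite: VoisinHodgeI2002, §7.3.1 Lemma 7.23] -/
theorem nonempty_centralizer_endAlg_algEquiv_of_hom_bijective (g : Hom H₁ H₂) (hg : Function.Bijective g.toLinearMap) :
    Nonempty (Subalgebra.centralizer ℚ (H₁.endAlg : Set (Module.End ℚ V)) ≃ₐ[ℚ]
      Subalgebra.centralizer ℚ (H₂.endAlg : Set (Module.End ℚ W))) := by
  have e := centralizerEndAlgComapEquivAlgEquiv H₂ (LinearEquiv.ofBijective g.toLinearMap hg)
  rw [← eq_comapEquiv_of_hom_bijective g hg] at e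
  exact ⟨e⟩

end Transport

/-! ## §2 «`V(A^r) = rV(A)` … identifies `C(A)` with `C(A^r)`»: an internal direct sum of copies of `H₀` -/

section IsotypicInternal

variable {V' : Type u} [AddCommGroup V'] [Module ℚ V'] [Module.Finite ℚ V'] {H' : HodgeStructure V' n}
  {W₀ : Type u} [AddCommGroup W₀] [Module ℚ W₀] [Module.Finite ℚ W₀] {H₀ : HodgeStructure W₀ n}
  {ι : Type} [Fintype ι] [DecidableEq ι] (T : ι → SubHodgeStructure H')
  (hT : DirectSum.IsInternal fun i => (T i).toSubmodule)
  (r : ∀ i, Hom H₀ (T i).toHodgeStructure) (hr : ∀ i, Function.Bijective (r i).toLinearMap)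

include hT hr

/-- **«`V(A^r) = rV(A)`»: `(xᵢ)ᵢ ↦ Σᵢ rᵢ(xᵢ)` is a BIJECTIVE morphism of Hodge structures `H₀^{⊕ι} → H'`** for an internal direct sum
`V' = ⊕ᵢ Tᵢ` with isomorphisms `rᵢ : H₀ ⥲ Tᵢ` (surjective onto `Σᵢ Tᵢ = V'`; injective by the dimension count `#ι · dim H₀ = dim V'`).
[cite: Milne1999LefschetzClasses, §1 p. 643] [cite: GreenGriffithsKerr2012, §V.B «Basic facts» (p. 159)] -/
theorem bijective_piDesc_subtypeHom_comp_toLinearMap :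
    Function.Bijective (Hom.piDesc (H := fun _ : ι => H₀) fun i => (T i).subtypeHom.comp (r i)).toLinearMap := by
  have hsurj : Function.Surjective (Hom.piDesc (H := fun _ : ι => H₀) fun i => (T i).subtypeHom.comp (r i)).toLinearMap := by
    rw [← LinearMap.range_eq_top, Hom.range_piDesc, ← hT.submodule_iSup_eq_top]
    refine iSup_congr fun i => ?_
    rw [Hom.comp_toLinearMap, LinearMap.range_comp_of_range_eq_top _ (LinearMap.range_eq_top.2 (hr i).2),
      SubHodgeStructure.subtypeHom_toLinearMap, Submodule.range_subtype]
  haveI : Module.Free ℚ W₀ := Module.Free.of_divisionRing ℚ W₀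
  have hdim : Module.finrank ℚ (ι → W₀) = Module.finrank ℚ V' := by
    rw [Module.finrank_pi_fintype, Finset.sum_const, Finset.card_univ, smul_eq_mul]
    exact card_mul_finrank_eq_finrank_of_isInternal T hT fun i => ⟨r i, hr i⟩
  exact ⟨(LinearMap.injective_iff_surjective_of_finrank_eq_finrank hdim).2 hsurj, hsurj⟩

/-- **«the diagonal action of `C(A)` on `rV(A)` identifies `C(A)` with `C(A^r)`», INTERNALLY: `C(H') ≃ₐ[ℚ] C(H₀)`** for an internal
direct sum `V' = ⊕ᵢ Tᵢ` (`ι ≠ ∅`) of sub-Hodge structures all isomorphic to `H₀` — transport along the Hodge isomorphism `H₀^{⊕ι} ⥲ H'`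
of the previous theorem, then p34's `C(H₀) ≃ₐ C(H₀^{⊕ι})`. [cite: Milne1999LefschetzClasses, §1 p. 643 and Prop. 1.1] -/
theorem nonempty_centralizer_endAlg_algEquiv_of_isInternal_of_forall_bijective [Nonempty ι] :
    Nonempty (Subalgebra.centralizer ℚ (H'.endAlg : Set (Module.End ℚ V')) ≃ₐ[ℚ]
      Subalgebra.centralizer ℚ (H₀.endAlg : Set (Module.End ℚ W₀))) := by
  obtain ⟨e⟩ := nonempty_centralizer_endAlg_algEquiv_of_hom_bijective _
    (bijective_piDesc_subtypeHom_comp_toLinearMap T hT r hr)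
  exact ⟨e.symm.trans (centralizerPiConstAlgEquiv (ι := ι) H₀).symm⟩

end IsotypicInternal

/-- Re-indexing an internal direct sum along an equivalence of index types. [folklore] -/
private theorem isInternal_comp_equiv {V' : Type u} [AddCommGroup V'] [Module ℚ V'] {ι ι' : Type*} [DecidableEq ι] [DecidableEq ι']
    {A : ι → Submodule ℚ V'} (hA : DirectSum.IsInternal A) (e : ι' ≃ ι) :
    DirectSum.IsInternal fun j => A (e j) := by
  refine (DirectSum.isInternal_submodule_iff_iSupIndep_and_iSup_eq_top _).2 ⟨?_, ?_⟩
  · exact hA.submodule_iSupIndep.comp e.injective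
  · rw [e.iSup_comp (g := A)]
    exact hA.submodule_iSup_eq_top

/-! ## §3 Prop. 1.1: `C(H) ≃ₐ[ℚ] Π_k C(T_k)` over the representatives of a labelled irreducible decomposition -/

section Labelled

variable {V : Type u} [AddCommGroup V] [Module ℚ V] [Module.Finite ℚ V] {H : HodgeStructure V n}
  {ι : Type*} [Fintype ι] [DecidableEq ι] (T : ι → SubHodgeStructure H)
  (hT : DirectSum.IsInternal fun i => (T i).toSubmodule) {κ : Finset ι} {c : ι → κ}
  (hc : ∀ i, ∃ g : Hom (T i).toHodgeStructure (T (c i)).toHodgeStructure, Function.Bijective g.toLinearMap)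
  (hκ : ∀ k k' : κ, (∃ g : Hom (T k).toHodgeStructure (T k').toHodgeStructure,
    Function.Bijective g.toLinearMap) → k = k')

include hT hc hκ

/-- **`C(W_k) ≃ₐ[ℚ] C(T_k)` for every isotypic block `W_k = ⨆_{c i = k} Tᵢ`** («`C(A_i^{r_i}) = C(A_i)`» internally: `W_k` is the
internal direct sum of the `Tᵢ`, `c i = k`, read inside it, all `≅ T_k`; §2 after re-indexing by `Fin m`).
[cite: Milne1999LefschetzClasses, §1 p. 643 and Prop. 1.1] [cite: GreenGriffithsKerr2012, §V.D (p. 164)] -/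
theorem nonempty_centralizer_endAlg_iSup'_fiber_algEquiv (k : κ) :
    Nonempty (Subalgebra.centralizer ℚ
        ((SubHodgeStructure.iSup' fun x : {i // c i = k} => T x.1).toHodgeStructure.endAlg :
          Set (Module.End ℚ (SubHodgeStructure.iSup' fun x : {i // c i = k} => T x.1).toSubmodule)) ≃ₐ[ℚ]
      Subalgebra.centralizer ℚ ((T k).toHodgeStructure.endAlg : Set (Module.End ℚ (T k).toSubmodule))) := by
  classical
  choose r hr using exists_hom_comapSubtype_bijective T hc k
  let eι := (Fintype.equivFin {i // c i = k}).symm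
  haveI : Nonempty (Fin (Fintype.card {i // c i = k})) := ⟨Fintype.equivFin _ ⟨k, apply_coe_eq T hc hκ k⟩⟩
  exact nonempty_centralizer_endAlg_algEquiv_of_isInternal_of_forall_bijective
    (fun j => (SubHodgeStructure.iSup' fun x : {i // c i = k} => T x.1).comapSubtype (T (eι j).1))
    (isInternal_comp_equiv (isInternal_comapSubtype_iSup'_fiber T hT c k) eι) (fun j => r (eι j)) fun j => hr (eι j)

/-- **MILNE'S PROPOSITION 1.1 on the Hodge structure itself: `C(H) ≃ₐ[ℚ] Π_k C(T_k)`** over the representatives `T_k`, `k ∈ κ`,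
of the isotypy classes of ANY isotypically-labelled irreducible decomposition of a finite-dimensional `ℚ`-Hodge structure
(«an isomorphism `C(A₁) × ⋯ × C(A_s) → C(A)` of `k`-algebras», `Aᵢ` representatives of the simple isogeny factors): restriction to
the Hom-orthogonal isotypic blocks `W_k` (g52-#3), then `C(W_k) ≃ₐ C(T_k)` block by block.
[cite: Milne1999LefschetzClasses, §1 Prop. 1.1 (p. 643)] [cite: Lange2023AbelianVarietiesComplex, §2.4.4 Cor. 2.4.26 (p. 124)] -/
theorem nonempty_centralizer_endAlg_algEquiv_pi_of_labelling (hirr : ∀ i, (T i).toHodgeStructure.IsIrreducible) :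
    Nonempty (Subalgebra.centralizer ℚ (H.endAlg : Set (Module.End ℚ V)) ≃ₐ[ℚ]
      Π k : κ, Subalgebra.centralizer ℚ ((T k).toHodgeStructure.endAlg : Set (Module.End ℚ (T k).toSubmodule))) := by
  classical
  obtain ⟨e, -⟩ := exists_algEquiv_pi_centralizer_of_hom_orthogonal
    (fun k : κ => SubHodgeStructure.iSup' fun x : {i // c i = k} => T x.1) (isInternal_iSup'_fiber T hT c)
    fun k l hkl f => hom_iSup'_fiber_eq_zero T hT hc hκ hirr hkl f
  exact ⟨e.trans (AlgEquiv.piCongrRight fun k =>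
    Classical.choice (nonempty_centralizer_endAlg_iSup'_fiber_algEquiv T hT hc hκ k))⟩

/-- **`dim_ℚ C(H) = Σ_k dim_ℚ C(T_k)`** over the representatives of the isotypy classes. [cite: Milne1999LefschetzClasses, §1 Prop. 1.1 (p. 643)] -/
theorem finrank_centralizer_endAlg_eq_sum_of_labelling (hirr : ∀ i, (T i).toHodgeStructure.IsIrreducible) :
    Module.finrank ℚ (Subalgebra.centralizer ℚ (H.endAlg : Set (Module.End ℚ V))) =
      ∑ k : κ, Module.finrank ℚ
        (Subalgebra.centralizer ℚ ((T k).toHodgeStructure.endAlg : Set (Module.End ℚ (T k).toSubmodule))) := by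
  obtain ⟨e⟩ := nonempty_centralizer_endAlg_algEquiv_pi_of_labelling T hT hc hκ hirr
  haveI : ∀ k : κ, Module.Free ℚ
      (Subalgebra.centralizer ℚ ((T k).toHodgeStructure.endAlg : Set (Module.End ℚ (T k).toSubmodule))) := fun k => by
    exact Module.Free.of_divisionRing ℚ
      (Subalgebra.centralizer ℚ ((T k).toHodgeStructure.endAlg : Set (Module.End ℚ (T k).toSubmodule)))
  rw [LinearEquiv.finrank_eq e.toLinearEquiv, Module.finrank_pi_fintype]

end Labelled

/-! ## §4 The canonical block: `C(S) ≃ₐ[ℚ] C(U)` for a minimal `E_φ`-stable `S ⊇ U` irreducible -/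

section Canonical

variable {V : Type u} [AddCommGroup V] [Module ℚ V] [Module.Finite ℚ V] {H : HodgeStructure V n}

/-- **`C(S) ≃ₐ[ℚ] C(U)` for a CANONICAL BLOCK**: for a polarizable `H`, a minimal non-zero `E_φ`-stable sub-Hodge structure `S`
and an irreducible `U ⊆ S`, Milne's centralizer of the Hodge structure `S ≅ U^{⊕m}` is that of `U` («identifies `C(A)` with
`C(A^r)`»; with g52-#3's `C(H) ≃ₐ Π_i C(S_i)` this is Prop. 1.1 over the canonical blocks).
[cite: Milne1999LefschetzClasses, §1 p. 643 and Prop. 1.1] [cite: GreenGriffithsKerr2012, §V.B «Basic facts» (third bullet) (p. 159)] -/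
theorem nonempty_centralizer_endAlg_algEquiv_of_minimal_stable (hH : H.IsPolarizable) {S U : SubHodgeStructure H}
    (hS : (∀ a ∈ H.endAlg, ∀ v ∈ S.toSubmodule, a v ∈ S.toSubmodule) ∧ S.toSubmodule ≠ ⊥ ∧
      ∀ S' : SubHodgeStructure H, (∀ a ∈ H.endAlg, ∀ v ∈ S'.toSubmodule, a v ∈ S'.toSubmodule) →
        S'.toSubmodule ≤ S.toSubmodule → S'.toSubmodule = ⊥ ∨ S'.toSubmodule = S.toSubmodule)
    (hU : U.toHodgeStructure.IsIrreducible) (hUS : U.toSubmodule ≤ S.toSubmodule) :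
    Nonempty (Subalgebra.centralizer ℚ (S.toHodgeStructure.endAlg : Set (Module.End ℚ S.toSubmodule)) ≃ₐ[ℚ]
      Subalgebra.centralizer ℚ (U.toHodgeStructure.endAlg : Set (Module.End ℚ U.toSubmodule))) := by
  classical
  -- an isotypically-labelled irreducible decomposition of `H`; `S` is one of its blocks `W_k`
  obtain ⟨s, _, κ, c, hint, hirr, hc, hκ⟩ := exists_isInternal_isIrreducible_labelling H hH
  obtain ⟨k, hk, -⟩ := existsUnique_iSup'_fiber_eq_of_minimal_stable (fun x : s => (x : SubHodgeStructure H)) hint hc hκ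
    (fun x => hirr x x.2) hS
  subst hk
  -- `C(W_k) ≃ₐ C(T_k)` (§3) and `C(T_k) ≃ₐ C(U)` (`T_k ≅ U`, both irreducible inside the block)
  obtain ⟨e₁⟩ := nonempty_centralizer_endAlg_iSup'_fiber_algEquiv (fun x : s => (x : SubHodgeStructure H)) hint hc hκ k
  have hTk : ((k : s) : SubHodgeStructure H).toSubmodule ≤
      (SubHodgeStructure.iSup' fun x : {i : s // c i = k} => ((x.1 : s) : SubHodgeStructure H)).toSubmodule := by
    rw [SubHodgeStructure.iSup'_toSubmodule]
    exact le_iSup (fun x : {i : s // c i = k} => ((x.1 : s) : SubHodgeStructure H).toSubmodule)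
      ⟨k, apply_coe_eq (fun x : s => (x : SubHodgeStructure H)) hc hκ k⟩
  obtain ⟨g, hg⟩ := (exists_hom_bijective_iff_eq_of_minimal_stable hH hS hS (hirr (k : s) (k : s).2) hU hTk hUS).2 rfl
  obtain ⟨e₂⟩ := nonempty_centralizer_endAlg_algEquiv_of_hom_bijective g hg
  exact ⟨e₁.trans e₂⟩

end Canonical

end HodgeStructure

end Literature.AlgebraicGeometry.Motives
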